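import Mathlib
import Summits.AnomalousDissipation.AnomalousDissipation.Theses.PointSink
import Literature.Analysis.FunctionSpaces.TorusCalculusProofs
import Literature.Analysis.FunctionSpaces.TorusFluidGlueProofs

/-!
# `PointSink.SolitonTransplant` (stmt-AnomalousDissipation-19035): the weighted steady energy
identity on `T^d` (support file for the bounded-family no-go `PointSinkBoundedNoGo.lean`)

For a steady classical solution `(u, p)` of the `f`-forced Navier–Stokes system with viscosity
`ν` on the flat torus and every smooth scalar weight `ψ`,

  `∫ (½‖u‖² + p) Dψ[u] = ν ∫ ψ ∑ᵢ‖∂ᵢu‖² + ν ∫ ∑ᵢ ∂ᵢψ ⟪u, ∂ᵢu⟫ − ∫ ψ ⟪f, u⟫`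

(`steady_weighted_energy_identity`): the energy flux through the level sets of `ψ` balances the
weighted dissipation, a viscous transport term and the weighted work of the force. Ingredients
(all integration by parts on the torus, no boundary terms, from `TorusCalculusProofs`):
`integral_mul_inner_convect_self` (`∫ ψ⟪(u·∇)u, u⟫ = −½∫ Dψ[u] ‖u‖²`, transport identity),
`integral_mul_inner_gradient` (`∫ ψ⟪∇p, u⟫ = −∫ p Dψ[u]`), `integral_mul_inner_laplacian`
(`∫ ψ⟪u, Δu⟫ = −∫ψ∑‖∂ᵢu‖² − ∫∑∂ᵢψ⟪u, ∂ᵢu⟫`). [folklore]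
-/

set_option linter.dupNamespace false  -- `Summit.AnomalousDissipation.AnomalousDissipation` is the mandated summit/problem namespace

noncomputable section

open MeasureTheory Metric Filter Topology Set
open scoped InnerProductSpace
open Literature.Analysis.FunctionSpaces Literature.Analysis.FunctionSpaces.Torus

namespace Summit.AnomalousDissipation.AnomalousDissipation.Theorems.SolitonTransplant.Negative

variable {d : Type*} [Fintype d] [DecidableEq d]

omit [DecidableEq d] in
/-- Products of smooth real functions on the torus are smooth. [folklore] -/
theorem isSmooth_mul {a b : UnitAddTorus d → ℝ} (ha : IsSmooth a) (hb : IsSmooth b) :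
    IsSmooth (fun y => a y * b y) :=
  ha.smul' hb

/-- Weighted transport identity: `∫ ψ ⟪(u·∇)u, u⟫ = −½ ∫ Dψ[u] ‖u‖²` for smooth divergence-free
`u` and smooth `ψ` (`Dψ[u]‖u‖² + 2ψ⟪(u·∇)u,u⟫ = D(ψ‖u‖²)[u]` integrates to zero). [folklore] -/
theorem integral_mul_inner_convect_self {u : UnitAddTorus d → EuclideanSpace ℝ d}
    {ψ : UnitAddTorus d → ℝ} (hu : IsSmooth u) (hdiv : IsDivFree u) (hψ : IsSmooth ψ) :
    ∫ x, ψ x * ⟪convect u u x, u x⟫_ℝ = -2⁻¹ * ∫ x, Torus.fderiv ψ x (u x) * ‖u x‖ ^ 2 := by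
  have hθ : IsSmooth (fun y => ψ y * ‖u y‖ ^ 2) := isSmooth_mul hψ hu.norm_sq
  have h0 := integral_fderiv_apply_eq_zero_of_isDivFree hu hθ hdiv
  have hpt : ∀ x, Torus.fderiv (fun y => ψ y * ‖u y‖ ^ 2) x (u x) =
      2 * (ψ x * ⟪convect u u x, u x⟫_ℝ) + Torus.fderiv ψ x (u x) * ‖u x‖ ^ 2 := by
    intro x
    have h := fderiv_smul_apply (a := ψ) (b := fun y => ‖u y‖ ^ 2) (hψ.isContDiff (by simp))
      (hu.norm_sq.isContDiff (by simp)) x (u x)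
    simp only [smul_eq_mul] at h
    rw [h, fderiv_norm_sq_apply (hu.isContDiff (by simp))]
    unfold Torus.convect
    rw [real_inner_comm (u x)]
    ring
  simp_rw [hpt] at h0
  have hI1 : Integrable (fun x => ψ x * ⟪convect u u x, u x⟫_ℝ) volume :=
    (isSmooth_mul hψ ((hu.convect hu).inner hu)).integrable
  have hI2 : Integrable (fun x => Torus.fderiv ψ x (u x) * ‖u x‖ ^ 2) volume :=
    (isSmooth_mul (hu.convect hψ) hu.norm_sq).integrable
  rw [integral_add (hI1.const_mul 2) hI2, integral_const_mul] at h0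
  linarith

/-- Weighted pressure identity: `∫ ψ ⟪∇p, u⟫ = −∫ p Dψ[u]` for smooth divergence-free `u` and
smooth `ψ`, `p` (`D(ψ p)[u]` integrates to zero). [folklore] -/
theorem integral_mul_inner_gradient {u : UnitAddTorus d → EuclideanSpace ℝ d}
    {ψ p : UnitAddTorus d → ℝ} (hu : IsSmooth u) (hdiv : IsDivFree u) (hψ : IsSmooth ψ)
    (hp : IsSmooth p) :
    ∫ x, ψ x * ⟪Torus.gradient p x, u x⟫_ℝ = -∫ x, p x * Torus.fderiv ψ x (u x) := by
  have hθ : IsSmooth (fun y => ψ y * p y) := isSmooth_mul hψ hp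
  have h0 := integral_fderiv_apply_eq_zero_of_isDivFree hu hθ hdiv
  have hpt : ∀ x, Torus.fderiv (fun y => ψ y * p y) x (u x) =
      ψ x * ⟪Torus.gradient p x, u x⟫_ℝ + p x * Torus.fderiv ψ x (u x) := by
    intro x
    have h := fderiv_smul_apply (a := ψ) (b := p) (hψ.isContDiff (by simp))
      (hp.isContDiff (by simp)) x (u x)
    simp only [smul_eq_mul] at h
    rw [h, Torus.inner_gradient_left]
    ring
  simp_rw [hpt] at h0
  have hI1 : Integrable (fun x => ψ x * ⟪Torus.gradient p x, u x⟫_ℝ) volume :=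
    (isSmooth_mul hψ (hp.gradient.inner hu)).integrable
  have hI2 : Integrable (fun x => p x * Torus.fderiv ψ x (u x)) volume :=
    (isSmooth_mul hp (hu.convect hψ)).integrable
  rw [integral_add hI1 hI2] at h0
  linarith

/-- Weighted viscous identity: `∫ ψ ⟪u, Δu⟫ = −∫ ψ ∑ᵢ‖∂ᵢu‖² − ∫ ∑ᵢ ∂ᵢψ ⟪u, ∂ᵢu⟫` for smooth `u`,
`ψ` (`ψ⟪u, ∂ᵢ∂ᵢu⟫ = ∂ᵢ(ψ⟪u, ∂ᵢu⟫) − ∂ᵢψ⟪u, ∂ᵢu⟫ − ψ‖∂ᵢu‖²`). [folklore] -/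
theorem integral_mul_inner_laplacian {u : UnitAddTorus d → EuclideanSpace ℝ d}
    {ψ : UnitAddTorus d → ℝ} (hu : IsSmooth u) (hψ : IsSmooth ψ) :
    ∫ x, ψ x * ⟪u x, laplacian u x⟫_ℝ =
      -(∫ x, ψ x * ∑ i, ‖partialDeriv i u x‖ ^ 2) -
        ∫ x, ∑ i, partialDeriv i ψ x * ⟪u x, partialDeriv i u x⟫_ℝ := by
  have hu1 : IsContDiff 1 u := hu.isContDiff (by simp)
  have hψ1 : IsContDiff 1 ψ := hψ.isContDiff (by simp)
  have hd1 : ∀ i, IsContDiff 1 (partialDeriv i u) := fun i => (hu.partialDeriv i).isContDiff (by simp)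
  have hg : ∀ i, IsSmooth (fun y => ⟪u y, partialDeriv i u y⟫_ℝ) := fun i => hu.inner (hu.partialDeriv i)
  have hg1 : ∀ i, IsContDiff 1 (fun y => ⟪u y, partialDeriv i u y⟫_ℝ) := fun i =>
    (hg i).isContDiff (by simp)
  -- pointwise identity, summand by summand
  have hpt : ∀ x, ψ x * ⟪u x, laplacian u x⟫_ℝ =
      ∑ i, (partialDeriv i (fun y => ψ y * ⟪u y, partialDeriv i u y⟫_ℝ) x -
        partialDeriv i ψ x * ⟪u x, partialDeriv i u x⟫_ℝ - ψ x * ‖partialDeriv i u x‖ ^ 2) := by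
    intro x
    rw [laplacian_eq_sum_partialDeriv_partialDeriv hu, inner_sum, Finset.mul_sum]
    refine Finset.sum_congr rfl fun i _ => ?_
    rw [partialDeriv_mul hψ1 (hg1 i), partialDeriv_inner hu1 (hd1 i), ← real_inner_self_eq_norm_sq]
    ring
  simp_rw [hpt]
  have hIa : ∀ i, Integrable (fun x => partialDeriv i (fun y => ψ y * ⟪u y, partialDeriv i u y⟫_ℝ) x)
      volume := fun i => ((isSmooth_mul hψ (hg i)).partialDeriv i).integrable
  have hIb : ∀ i, Integrable (fun x => partialDeriv i ψ x * ⟪u x, partialDeriv i u x⟫_ℝ) volume :=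
    fun i => (isSmooth_mul (hψ.partialDeriv i) (hg i)).integrable
  have hIc : ∀ i, Integrable (fun x => ψ x * ‖partialDeriv i u x‖ ^ 2) volume :=
    fun i => (isSmooth_mul hψ (hu.partialDeriv i).norm_sq).integrable
  have hIabc : ∀ i, Integrable (fun x => partialDeriv i (fun y => ψ y * ⟪u y, partialDeriv i u y⟫_ℝ) x -
      partialDeriv i ψ x * ⟪u x, partialDeriv i u x⟫_ℝ - ψ x * ‖partialDeriv i u x‖ ^ 2) volume :=
    fun i => ((hIa i).sub (hIb i)).sub (hIc i)
  rw [integral_finsetSum _ fun i _ => hIabc i]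
  have hterm : ∀ i, ∫ x, (partialDeriv i (fun y => ψ y * ⟪u y, partialDeriv i u y⟫_ℝ) x -
      partialDeriv i ψ x * ⟪u x, partialDeriv i u x⟫_ℝ - ψ x * ‖partialDeriv i u x‖ ^ 2) =
      -(∫ x, ψ x * ‖partialDeriv i u x‖ ^ 2) -
        ∫ x, partialDeriv i ψ x * ⟪u x, partialDeriv i u x⟫_ℝ := by
    intro i
    have hIab : Integrable (fun x => partialDeriv i (fun y => ψ y * ⟪u y, partialDeriv i u y⟫_ℝ) x -
        partialDeriv i ψ x * ⟪u x, partialDeriv i u x⟫_ℝ) volume := (hIa i).sub (hIb i)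
    rw [integral_sub hIab (hIc i), integral_sub (hIa i) (hIb i),
      integral_partialDeriv_eq_zero_holds (isSmooth_mul hψ (hg i)) i]
    ring
  simp_rw [hterm]
  rw [Finset.sum_sub_distrib, Finset.sum_neg_distrib,
    ← integral_finsetSum _ fun i _ => hIc i, ← integral_finsetSum _ fun i _ => hIb i]
  congr 1
  · congr 1
    refine integral_congr_ae (ae_of_all _ fun x => ?_)
    simp only [Finset.mul_sum]

/-- **Weighted steady energy identity.** For a steady classical solution of the `f`-forced
Navier–Stokes system with viscosity `ν` on `T^d` (a time-constant `IsClassicalNSSolutionOn univ`)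
and a smooth scalar weight `ψ`:
`∫ (½‖u‖² + p) Dψ[u] = ν∫ψ∑ᵢ‖∂ᵢu‖² + ν∫∑ᵢ∂ᵢψ⟪u, ∂ᵢu⟫ − ∫ψ⟪f, u⟫` — the energy flux across
the level sets of `ψ` (Bernoulli transport `(½|u|²+p)u`) equals weighted dissipation plus viscous
transport minus weighted work (Doering–Foias 2002 §2 localised; `ψ ≡ 1` is the steady energy
identity `ν‖∇u‖² = ∫⟪f,u⟫`). [folklore] -/
theorem steady_weighted_energy_identity {ν : ℝ} {f u : UnitAddTorus d → EuclideanSpace ℝ d}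
    {p : UnitAddTorus d → ℝ}
    (h : IsClassicalNSSolutionOn Set.univ ν (fun _ => f) (fun _ => u) (fun _ => p))
    {ψ : UnitAddTorus d → ℝ} (hψ : IsSmooth ψ) :
    ∫ x, (2⁻¹ * ‖u x‖ ^ 2 + p x) * Torus.fderiv ψ x (u x) =
      ν * (∫ x, ψ x * ∑ i, ‖partialDeriv i u x‖ ^ 2) +
        ν * (∫ x, ∑ i, partialDeriv i ψ x * ⟪u x, partialDeriv i u x⟫_ℝ) -
        ∫ x, ψ x * ⟪f x, u x⟫_ℝ := by
  have hu : IsSmooth u := h.smooth_velocity.isSmooth_slice (Set.mem_univ (0 : ℝ))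
  have hp : IsSmooth p := h.smooth_pressure.isSmooth_slice (Set.mem_univ (0 : ℝ))
  have hdiv : IsDivFree u := h.divFree 0 (Set.mem_univ _)
  -- the force is smooth: it is a combination of smooth terms by the momentum equation
  have hmom : ∀ x, convect u u x = ν • laplacian u x - Torus.gradient p x + f x := by
    intro x
    have hm := h.momentum 0 (Set.mem_univ _) x
    have ht : timeDerivWithin Set.univ (fun _ : ℝ => u) 0 x = 0 := by
      simp [timeDerivWithin]
    rw [ht, zero_add] at hm
    exact hm
  have hf : IsSmooth f := by
    have hfeq : f = fun x => convect u u x - ν • laplacian u x + Torus.gradient p x := by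
      funext x; rw [hmom x]; abel
    rw [hfeq]
    exact ((hu.convect hu).sub ((hu.laplacian).smul ν)).add hp.gradient
  -- pair the momentum equation with `ψ u` and integrate
  have hpair : ∀ x, ψ x * ⟪convect u u x, u x⟫_ℝ =
      ν * (ψ x * ⟪u x, laplacian u x⟫_ℝ) - ψ x * ⟪Torus.gradient p x, u x⟫_ℝ +
        ψ x * ⟪f x, u x⟫_ℝ := by
    intro x
    rw [hmom x, inner_add_left, inner_sub_left, inner_smul_left, real_inner_comm (u x)]
    simp only [RCLike.conj_to_real]
    ring
  have hA := integral_mul_inner_convect_self hu hdiv hψ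
  have hB := integral_mul_inner_gradient hu hdiv hψ hp
  have hC := integral_mul_inner_laplacian hu hψ
  have hI1 : Integrable (fun x => ψ x * ⟪u x, laplacian u x⟫_ℝ) volume :=
    (isSmooth_mul hψ (hu.inner hu.laplacian)).integrable
  have hI2 : Integrable (fun x => ψ x * ⟪Torus.gradient p x, u x⟫_ℝ) volume :=
    (isSmooth_mul hψ (hp.gradient.inner hu)).integrable
  have hI3 : Integrable (fun x => ψ x * ⟪f x, u x⟫_ℝ) volume :=
    (isSmooth_mul hψ (hf.inner hu)).integrable
  have hlhs : ∫ x, ψ x * ⟪convect u u x, u x⟫_ℝ =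
      ν * (∫ x, ψ x * ⟪u x, laplacian u x⟫_ℝ) - (∫ x, ψ x * ⟪Torus.gradient p x, u x⟫_ℝ) +
        ∫ x, ψ x * ⟪f x, u x⟫_ℝ := by
    simp_rw [hpair]
    have hI12 : Integrable (fun x => ν * (ψ x * ⟪u x, laplacian u x⟫_ℝ) -
        ψ x * ⟪Torus.gradient p x, u x⟫_ℝ) volume := (hI1.const_mul ν).sub hI2
    rw [integral_add hI12 hI3, integral_sub (hI1.const_mul ν) hI2, integral_const_mul]
  -- expand the flux integrand
  have hIf1 : Integrable (fun x => Torus.fderiv ψ x (u x) * ‖u x‖ ^ 2) volume :=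
    (isSmooth_mul (hu.convect hψ) hu.norm_sq).integrable
  have hIf2 : Integrable (fun x => p x * Torus.fderiv ψ x (u x)) volume :=
    (isSmooth_mul hp (hu.convect hψ)).integrable
  have hflux : ∫ x, (2⁻¹ * ‖u x‖ ^ 2 + p x) * Torus.fderiv ψ x (u x) =
      2⁻¹ * (∫ x, Torus.fderiv ψ x (u x) * ‖u x‖ ^ 2) + ∫ x, p x * Torus.fderiv ψ x (u x) := by
    have : (fun x => (2⁻¹ * ‖u x‖ ^ 2 + p x) * Torus.fderiv ψ x (u x)) =
        fun x => 2⁻¹ * (Torus.fderiv ψ x (u x) * ‖u x‖ ^ 2) + p x * Torus.fderiv ψ x (u x) := by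
      funext x; ring
    rw [this, integral_add (hIf1.const_mul _) hIf2, integral_const_mul]
  rw [hflux]
  rw [hA, hB, hC] at hlhs
  linarith

end Summit.AnomalousDissipation.AnomalousDissipation.Theorems.SolitonTransplant.Negative

end
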